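import Literature.AnabelianGeometry.EtaleTheta.FrobenioidThetaBiKummerOfModel
import Literature.AnabelianGeometry.EtaleTheta.Discharge.Sec4Prop42SubBaseLift
import Literature.AnabelianGeometry.EtaleTheta.Discharge.Sec4RootDivisors

/-!
# [EtTh] Prop. 5.2 (i) / Rmk. 4.3.2: an `N`-th root of an `l`-th root of `Θ̈` is an `l·N`-th root — AT THE
# CANONICAL MODEL of the §4 setting (GAP row G-L2t4-1, sub-rows G-L2t4-1a/b)

Mochizuki, *The étale theta function and its Frobenioid-theoretic manifestations*, Publ. RIMS **45**
(2009): Prop. 5.2 (i), PDF p. 98 (printed p. 324) «The pair of morphisms of `C` determined by "`s_{l·N}`",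
"`τ_{l·N}`" constitutes an `l·N`-th root of a right fraction-pair … of the theta function `Θ̈` …, or,
alternatively, an `N`-th root of a right fraction-pair … of an `l`-th root of the theta function `Θ̈`
[cf. Remark 4.3.2]», whose printed proof reads «In the case of assertion (i), we observe that the
"`(l·N, H_⊙, f|_{A_{l·N}})`-saturated-ness" condition of Proposition 4.2, (iii), follows immediately from the
definition of the field `J̈_{l·N}` in §1»; and Rmk. 4.3.2, PDF pp. 92–93 (printed pp. 318–319) «given an
`N`-th root …, there exists a "morphism" from a SUITABLE `N'`-th root … For instance, such a "morphism" may
be constructed by extracting an "`N'/N`-th root" [cf. Proposition 4.2, (iii)] of the [fraction-pair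
determined by the] given "`N`-th root"».  [cite: MochizukiEtTh2009, Prop 5.2 (i) p.324 (PDF p.98)]
[cite: MochizukiEtTh2009, Rmk 4.3.2 p.318–319 (PDF pp.92–93)]

abc-iut cell, layer L2, PROOF-ONLY companion (no `def`), seat abc-iut-w5-d134 (gen 3), GAP-LEDGER row
G-L2t4-1 (abc-iut-L2-t4: the binder `hcomp : S.PairIsNthRootOf pullFrac ((lv : ℕ) * N) θ R.pair.num
R.pair.den` of `ThetaFrobenioid.thetaPairIsRoot_ofBiKummerData`, `FrobenioidThetaOfBiKummerData.lean`) and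
its sub-rows G-L2t4-1a (composite base-Frobenius-type datum), G-L2t4-1b (`(l·N, H_⊙)`-saturation of the
`N`-domain) filed with abc-iut-w5-d234's generic packaging `BiKummerSetting.NthRoot.comp` / `hcomp_of`
(`BiKummerRootComposition.lean`, p424490).

WHAT IS PROVED.  For abc-iut-L2-t9's canonical model `S := BiKummerSetting.mkOfModelCanonical …` of
abc-iut-L2-t3's §4 setting (pull-back of birational units `pullFrac := TemperedFrobenioid.pullFracModel`,
`Φ` divisorial), an `l`-th root datum `Rl : S.NthRoot θ Pl lv _` of a right fraction-pair `Pl` of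
`θ = Θ̈ ∈ O^×(A_⊙^birat)` and an `N`-th root datum `R : S.NthRoot Rl.root Rl.pair N _` of the root's pair:
* `BiKummerSetting.pairIsNthRootOf_comp_mkOfModelCanonical` — **`hcomp` holds**, i.e. `(s^⊓_N, s^⊔_N) =
  (R.pair.num, R.pair.den)` is (up to isomorphism of roots) the root pair of an `l·N`-th root of `Pl`,
  PROVIDED the `N`-domain `A_N := R.AN` is `μ_{l·N}`-saturated (`hμ`) and satisfies condition (a) of
  Def. 4.1 (iii) at level `l·N` (`hcondA`: pre-steps `A' → A_N`, `A' → A''` with `A''` Frobenius-trivial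
  and `(l·N, H_⊙^{bs-fld})`-saturated) — print's «follows immediately from the definition of the field
  `J̈_{l·N}`» — and `A_N` lies in a skeleton through `A_⊙` (`hsk`, the clause of the L2-lead ruling
  2026-08-26T03:05Z on L01′/L03′: `A_N^bs ≅ A_⊙^bs` only if `A_N = A_⊙`; [FrdI] Def. 2.7 (i)(a)).
* The `l·N`-th root is BUILT on `(A_N, B_N, f_N, (s^⊓_N, s^⊔_N))` with `α := F(l·N)_{A_N} ≫ φ` for the
  base-Frobenius pair of the model Frobenioid containing `A_N` and `A_⊙` ([FrdI] Thm. 5.2 p. 101 /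
  Prop. 5.6; this seat's `ModelFrobenioid.exists_isBaseFrobeniusPair_through`, p420020) and `φ` THE arrow of
  the pair over `Base(R.α ≫ Rl.α)` — so condition (e) of Def. 4.1 (iv) holds by construction (engine
  `Prop42Sub.exists_baseFrobeniusTypeData_of_isDistinguished`, p420474); `β` comes from L04
  `Prop42Sub.rootSquares_mkOfModel` (abc-iut-w5-d134 gen 0, p415074); `f_N^{l·N} = Θ̈|_{A_N}` from
  `f_N^N = f_l|_{A_N}`, `f_l^l = Θ̈|_{A_l}` and the functoriality of `pullFracModel`; `(l·N)·Div(s^⊓_N) =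
  Base(α)^* Div(s)` from abc-iut-L6-t12's `NthRoot.div_num_pow` twice; ampleness, `H_{A_N}`-fixedness and
  condition (b) of the level-`l·N` saturation are DERIVED from `R.isSaturated` (`IsSaturated.of_pow_root`).
* READING recorded for G-L2t4-1a: the datum is needed for SOME degree-`l·N` isometry `A_N → A_⊙` of
  base-Frobenius type over `Base(R.α ≫ Rl.α)`, not for the literal composite `R.α ≫ Rl.α` (which, at the
  model, is of base-Frobenius type only when a certain unit of `A_N` — the mismatch of the trivialisations
  of `A_l` used by the two base-Frobenius pairs behind `R.αData`, `Rl.αData` — admits an `N`-th root);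
  `PairIsNthRootOf` fixes the root PAIR up to isomorphism, not `α`, so `α` may be re-chosen.  G-L2t4-1b is
  thereby REDUCED, at the model, to exactly `hμ` + `hcondA`; G-L2t4-1c (multiplicativity of the pull-back
  of birational units) is `map_pow` for the monoid homomorphism `pullFracModel` and is not restated.
HONEST FRAMING: kernel-checked consequences for data so typed; nothing asserts that such root data exist
for an actual curve; no side is taken on [IUTchIII] Cor. 3.12; typed ≠ proved for Prop. 5.2 (i) itself.
-/

noncomputable section

namespace Literature.AnabelianGeometry.EtaleTheta

open CategoryTheory Opposite Literature.AlgebraicGeometry.Frobenioids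

universe u₀ v₀ u v w

/-! ### Functoriality of the pull-back of birational units in the model -/

namespace TemperedFrobenioid

variable {D₀ : Type u₀} [Category.{v₀} D₀] {V : FrdIMonoidStub.{w}} {T : RealifiedDivisorMonoids (D₀ := D₀) V}
  {D : Type u} [Category.{v} D] {VD : FrdICatStub.{u, v, w} D} (C : TemperedFrobenioid T D VD)

/-- `((−)^birat)^*` only depends on `Base`: two morphisms `A' → A` of the model with the same base map pull
birational units back identically ([FrdI] Prop. 1.11 (iv); `pullFracModel φ = B(Base φ)` on units).
[cite: MochizukiEtTh2009, Prop 4.2 p.314 (PDF p.88)] -/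
theorem pullFracModel_eq_of_baseMap_eq {A A' : C.category} {φ φ' : A' ⟶ A}
    (h : ModelFrobenioid.baseMap φ = ModelFrobenioid.baseMap φ') : C.pullFracModel φ = C.pullFracModel φ' := by
  unfold pullFracModel
  rw [h]

/-- `((ψ ∘ φ)^birat)^* = (φ^birat)^* ∘ (ψ^birat)^*` (contravariance of `B`).
[cite: MochizukiEtTh2009, Prop 4.2 p.314 (PDF p.88)] -/
theorem pullFracModel_comp_apply {A B E : C.category} (φ : A ⟶ B) (ψ : B ⟶ E) (x : C.biratUnitsModel E) :
    C.pullFracModel (φ ≫ ψ) x = C.pullFracModel φ (C.pullFracModel ψ x) := by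
  apply Units.ext
  rw [coe_pullFracModel_apply, coe_pullFracModel_apply, coe_pullFracModel_apply, ModelFrobenioid.baseMap_comp,
    op_comp, Functor.map_comp, CommMonCat.comp_apply]

end TemperedFrobenioid

namespace BiKummerSetting

/-! ### Generic bookkeeping over an arbitrary §4 setting -/

section Generic

variable {K : Type u₀} [Field K] {X : SemiGraphs.TemperedArithmeticGroup.{u₀} K} {D₀ : Type u₀} [Category.{v₀} D₀]
  {V : FrdIMonoidStub.{w}} {T : RealifiedDivisorMonoids (D₀ := D₀) V} {D : Type u} [Category.{v} D]
  {VD : FrdICatStub.{u, v, w} D} {S : BiKummerSetting X T D VD}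

/-- **Def. 4.1 (iii) at a multiple level for a power.** If `A` is `(N, H_⊙, x)`-saturated and `g^N = x` in
`O^×(A^birat)`, then `A` is `(M·N, H_⊙, x^M)`-saturated as soon as condition (a) holds at level `M·N`
(pre-steps `A' → A`, `A' → A''` with `A''` Frobenius-trivial and `(M·N, H_⊙^{bs-fld})`-saturated): `H_⊙`-ampleness
is unchanged, `H_A` fixes `x^M` because it fixes `x` and acts by group automorphisms, and `g^{M·N} = x^M` is
condition (b).  [cite: MochizukiEtTh2009, Def 4.1 (iii) p.313 (PDF p.87)] -/
theorem IsSaturated.of_pow_root {A : S.C} {N : ℕ+} {x : S.biratUnits A} (hs : S.IsSaturated A N x)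
    {g : S.biratUnits A} (hg : g ^ (N : ℕ) = x) (M : ℕ+)
    (hcondA : ∃ (A' A'' : S.C) (s₁ : A' ⟶ A) (s₂ : A' ⟶ A''), S.IsPreStep s₁ ∧ S.IsPreStep s₂ ∧
      S.IsFrobeniusTrivial A'' ∧ S.IsNHSaturatedBsFld S.HodotBsFld A'' (M * N)) :
    S.IsSaturated A (M * N) (x ^ (M : ℕ)) where
  isAmple := hs.isAmple
  fixed σ hσ := by rw [map_pow, hs.fixed σ hσ]
  cond_a := hcondA
  cond_b := ⟨g, by rw [PNat.mul_coe, pow_mul', hg]⟩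

variable {pullFrac : ∀ {A A' : S.C} (_ : A' ⟶ A), S.biratUnits A → S.biratUnits A'}
  {A Bl : S.C} {θ : S.biratUnits A} {Pl : S.FractionPair θ Bl} {lv N : ℕ+}
  (Rl : S.NthRoot θ Pl lv pullFrac) (R : S.NthRoot Rl.root Rl.pair N pullFrac)

/-- **Rmk. 4.3.2, packaging with a RE-CHOSEN `α`.**  Let `Rl` be an `l`-th root of a right fraction-pair `Pl`
of `θ` and `R` an `N`-th root of the root's pair (`N`-domain `A_N`, `N`-codomain `B_N`, root `f_N`, root pair
`(s'_N, s''_N)`).  Then `(s'_N, s''_N)` is [the root pair of] an `l·N`-th root of `Pl` as soon as there are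
SOME `α : A_N → A` carrying data of base-Frobenius type, an isometry of Frobenius degree `l·N`, whose
pull-back part `α'` pulls `θ` back to `f_N^{l·N}` with `A_N` `(l·N, H_⊙, (α')^*θ)`-saturated, and SOME isometry
`β : B_N → B` of Frobenius degree `l·N` completing the two squares — neither `α` nor `β` is required to be
the composite `R.α ≫ Rl.α`, `R.β ≫ Rl.β` (Prop. 4.2 (iv): roots are determined up to isomorphism of the
data `(A_N, B_N, s'_N, s''_N)`).  [cite: MochizukiEtTh2009, Rmk 4.3.2 p.318–319 (PDF pp.92–93)] -/
theorem NthRoot.pairIsNthRootOf_mul_of_data (α : R.AN ⟶ A) (d : S.BaseFrobeniusTypeData α)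
    (hiso : S.IsIsometry α) (hdeg : S.degFr α = lv * N)
    (hroot : R.root ^ ((lv * N : ℕ+) : ℕ) = pullFrac d.α₁ θ) (hsat : S.IsSaturated R.AN (lv * N) (pullFrac d.α₁ θ))
    (β : R.BN ⟶ Bl) (hβiso : S.IsIsometry β) (hβdeg : S.degFr β = lv * N)
    (hcn : R.pair.num ≫ β = α ≫ Pl.num) (hcd : R.pair.den ≫ β = α ≫ Pl.den) :
    S.PairIsNthRootOf pullFrac ((lv : ℕ) * N) θ R.pair.num R.pair.den := by
  have h := S.pairIsNthRootOf_nthRoot pullFrac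
    ({ AN := R.AN, BN := R.BN, α := α, β := β, root := R.root, pair := R.pair, comm_num := hcn,
       comm_den := hcd, isIsometry := ⟨hiso, hβiso, hdeg, hβdeg⟩, αData := d, pow_root := hroot,
       isSaturated := hsat } : S.NthRoot θ Pl (lv * N) pullFrac)
  rwa [PNat.mul_coe] at h

/-- The composite base map of the two roots is that of the two pull-back parts: `Base(R.α ≫ Rl.α) =
Base(α'_N) ≫ Base(α'_l)` (`α''` base-identity, Def. 4.1 (iv)(c)).  [cite: MochizukiEtTh2009, Def 4.1 (iv) p.313 (PDF p.87)] -/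
theorem NthRoot.baseMap_α_eq {A B : S.C} {f : S.biratUnits A} {P : S.FractionPair f B} {M : ℕ+}
    (Q : S.NthRoot f P M pullFrac) :
    ModelFrobenioid.baseMap Q.α = ModelFrobenioid.baseMap Q.αData.α₁ := by
  have hb : ModelFrobenioid.baseMap Q.αData.α₂ = 𝟙 _ := Q.αData.cond_c.1
  have h := congrArg ModelFrobenioid.baseMap Q.αData.fac
  rw [ModelFrobenioid.baseMap_comp, hb, Category.id_comp] at h
  exact h.symm

/-- **`(l·N) · Div(s'_N) = Base(φ)^* Div(s')`** for the root pair of `R` and any `φ : A_N → A` over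
`Base(α'_N) ≫ Base(α'_l)`, from the two root squares (abc-iut-L6-t12's `NthRoot.div_num_pow` for `R` and for
`Rl`).  [cite: MochizukiEtTh2009, Prop 4.3 (i) p.317 (PDF p.91)] -/
theorem NthRoot.div_num_pow_mul (φ : R.AN ⟶ A)
    (hb : ModelFrobenioid.baseMap φ = ModelFrobenioid.baseMap R.αData.α₁ ≫ ModelFrobenioid.baseMap Rl.αData.α₁) :
    ModelFrobenioid.div R.pair.num ^ ((lv * N : ℕ+) : ℕ) =
      pull S.tf.divisorMonoid (ModelFrobenioid.baseMap φ) (ModelFrobenioid.div Pl.num) := by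
  rw [hb, PNat.mul_coe, pow_mul', R.div_num_pow, ← map_pow, Rl.div_num_pow, ← R.baseMap_α_eq, ← Rl.baseMap_α_eq,
    pull_comp]

/-- **`(l·N) · Div(s''_N) = Base(φ)^* Div(s'')`** likewise.  [cite: MochizukiEtTh2009, Prop 4.3 (i) p.317 (PDF p.91)] -/
theorem NthRoot.div_den_pow_mul (φ : R.AN ⟶ A)
    (hb : ModelFrobenioid.baseMap φ = ModelFrobenioid.baseMap R.αData.α₁ ≫ ModelFrobenioid.baseMap Rl.αData.α₁) :
    ModelFrobenioid.div R.pair.den ^ ((lv * N : ℕ+) : ℕ) =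
      pull S.tf.divisorMonoid (ModelFrobenioid.baseMap φ) (ModelFrobenioid.div Pl.den) := by
  rw [hb, PNat.mul_coe, pow_mul', R.div_den_pow, ← map_pow, Rl.div_den_pow, ← R.baseMap_α_eq, ← Rl.baseMap_α_eq,
    pull_comp]

/-- **The root bookkeeping `f_N^{l·N} = (φ^birat)^* θ`** for any `φ : A_N → A` that pulls `θ` back through
`A_l` (`(φ^birat)^* θ = (α'_N{}^birat)^* (α'_l{}^birat)^* θ`), given multiplicativity of `(α'_N{}^birat)^*` —
from `f_N^N = (α'_N)^* f_l` and `f_l^l = (α'_l)^* θ`.  [cite: MochizukiEtTh2009, Rmk 4.3.2 p.318–319 (PDF pp.92–93)] -/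
theorem NthRoot.pow_root_mul_of_laws (φ : R.AN ⟶ A)
    (hmul : ∀ (x : S.biratUnits Rl.AN) (n : ℕ), pullFrac R.αData.α₁ (x ^ n) = pullFrac R.αData.α₁ x ^ n)
    (hφ : pullFrac φ θ = pullFrac R.αData.α₁ (pullFrac Rl.αData.α₁ θ)) :
    R.root ^ ((lv * N : ℕ+) : ℕ) = pullFrac φ θ := by
  rw [PNat.mul_coe, pow_mul', R.pow_root, ← hmul, Rl.pow_root, hφ]

/-- Under the same laws, `(φ^birat)^* θ = ((α'_N{}^birat)^* f_l)^l`.  [cite: MochizukiEtTh2009, Rmk 4.3.2 p.318–319 (PDF pp.92–93)] -/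
theorem NthRoot.pullFrac_eq_pow_of_laws (φ : R.AN ⟶ A)
    (hmul : ∀ (x : S.biratUnits Rl.AN) (n : ℕ), pullFrac R.αData.α₁ (x ^ n) = pullFrac R.αData.α₁ x ^ n)
    (hφ : pullFrac φ θ = pullFrac R.αData.α₁ (pullFrac Rl.αData.α₁ θ)) :
    pullFrac φ θ = pullFrac R.αData.α₁ Rl.root ^ (lv : ℕ) := by
  rw [hφ, ← Rl.pow_root, hmul]

/-- **The level-`l·N` saturation of the `N`-domain** (Def. 4.1 (iii) for `(l·N, H_⊙, (φ^birat)^* θ)`), DERIVED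
from the level-`N` saturation carried by `R` (ampleness, fixedness, condition (b) with the root `f_N`) and
condition (a) at level `l·N` (input `hcondA` — print: «follows immediately from the definition of the field
`J̈_{l·N}`», proof of Prop. 5.2 (i), p.324).  [cite: MochizukiEtTh2009, Prop 5.2 (i) p.324 (PDF p.98)] -/
theorem NthRoot.isSaturated_mul_of_laws (φ : R.AN ⟶ A)
    (hmul : ∀ (x : S.biratUnits Rl.AN) (n : ℕ), pullFrac R.αData.α₁ (x ^ n) = pullFrac R.αData.α₁ x ^ n)
    (hφ : pullFrac φ θ = pullFrac R.αData.α₁ (pullFrac Rl.αData.α₁ θ))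
    (hcondA : ∃ (A' A'' : S.C) (s₁ : A' ⟶ R.AN) (s₂ : A' ⟶ A''), S.IsPreStep s₁ ∧ S.IsPreStep s₂ ∧
      S.IsFrobeniusTrivial A'' ∧ S.IsNHSaturatedBsFld S.HodotBsFld A'' (lv * N)) :
    S.IsSaturated R.AN (lv * N) (pullFrac φ θ) := by
  rw [NthRoot.pullFrac_eq_pow_of_laws Rl R φ hmul hφ]
  exact IsSaturated.of_pow_root R.isSaturated R.pow_root lv hcondA

end Generic

/-! ### At the canonical model `mkOfModelCanonical` -/

section Canonical

variable {K : Type u₀} [Field K] (X : SemiGraphs.TemperedArithmeticGroup.{u₀} K) {D₀ : Type u₀}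
  [Category.{v₀} D₀] {V : FrdIMonoidStub.{w}} {T : RealifiedDivisorMonoids (D₀ := D₀) V}
  {D : Type u} [Category.{v} D] {VD : FrdICatStub.{u, v, w} D}
  (tf : TemperedFrobenioid T D VD) (hZ : tf.monoidType = MonoidType.Z)
  (hP : ∀ A : Dᵒᵖ, IsPerfect (tf.Φ.carrier A)) (IG : D → Prop) (gS : ∀ A : D, IG A → (X.Pi →* Aut A))
  (gSs : ∀ (A : D) (h : IG A), Function.Surjective (gS A h))
  (NH : Subgroup (Field.absoluteGaloisGroup K) → tf.category → ℕ+ → Prop) (A₀ : tf.category)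
  (hA₀ : PreFrobenioid.IsFrobeniusTrivial tf.toElem A₀) (hA₀' : IG A₀.base)
  (hΦd : Objectwise (fun M _ => IsDivisorial M) tf.divisorMonoid)

include hA₀ hΦd in
/-- **A base-Frobenius pair of the model through `A_N` and `A_⊙`** ([FrdI] Thm. 5.2 p. 101 / Prop. 5.6): for
`Φ` divisorial, a principal (Frobenius-trivial) `A_⊙` and an object `A_N` admitting a pull-back morphism
`φ₀ : A_N → A_⊙` and lying in a skeleton through `A_⊙` (`A_N^bs ≅ A_⊙^bs` only if `A_N = A_⊙`), some
base-Frobenius pair `(P, F)` of the model Frobenioid has both `A_N` and `A_⊙` among the objects of its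
base-section.  [cite: MochizukiFrdI2008, Prop. 5.6 p.105] -/
theorem exists_isBaseFrobeniusPair_obj_obj (AN : tf.category) (φ₀ : AN ⟶ A₀)
    (hφ₀ : PreFrobenioid.IsPullbackMorphism tf.toElem φ₀) (hsk : Nonempty (AN.base ≅ A₀.base) → AN = A₀) :
    ∃ (P : Presection tf.category) (Fr : ℕ+ →* End P.ι),
      PreFrobenioid.IsBaseFrobeniusPair tf.toElem P Fr ∧ P.obj AN ∧ P.obj A₀ := by
  have hBg := tf.isGroupLike_ratFnFunctor T.isUnit_BΛ
  have hA₀p := ModelFrobenioid.exists_cls_eq_divB_of_isFrobeniusTrivial A₀ hA₀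
  by_cases hne : Nonempty (AN.base ≅ A₀.base)
  · have hEq : AN = A₀ := hsk hne
    obtain ⟨P, Fr, hPF, hobj⟩ := ModelFrobenioid.exists_isBaseFrobeniusPair_obj hΦd hBg A₀ hA₀p
    refine ⟨P, Fr, hPF, ?_, hobj⟩
    rw [hEq]
    exact hobj
  · obtain ⟨hn, hd⟩ := ModelFrobenioid.degFr_div_of_isPullbackMorphism hΦd hφ₀
    obtain ⟨P, Fr, hPF, hφ₀P⟩ := ModelFrobenioid.exists_isBaseFrobeniusPair_through hΦd hBg φ₀ hn hd hA₀p hne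
    exact ⟨P, Fr, hPF, (P.obj_of_hom φ₀ hφ₀P).1, (P.obj_of_hom φ₀ hφ₀P).2⟩

/-- **THE arrow of a base-section over a prescribed base map** (Def. 2.7 (i)(c): `P ⥲ D` is an equivalence,
in particular full): two objects of `P` and a morphism of their bases give a `P`-distinguished morphism over
it.  [cite: MochizukiFrdI2008, Def. 2.7 (i) p.51] -/
theorem exists_hom_over_of_isBaseSection {P : Presection tf.category}
    (hP : PreFrobenioid.IsBaseSection tf.toElem P) {AN A : tf.category} (hAN : P.obj AN) (hA : P.obj A)
    (b : AN.base ⟶ A.base) :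
    ∃ φ : AN ⟶ A, P.hom φ ∧ ModelFrobenioid.baseMap φ = b := by
  haveI := hP.isEquivalence
  let ANP : P.Cat := ⟨AN, hAN⟩
  let AP : P.Cat := ⟨A, hA⟩
  let b' : (P.toBase tf.toElem).obj ANP ⟶ (P.toBase tf.toElem).obj AP := b
  let φP : ANP ⟶ AP := (P.toBase tf.toElem).preimage b'
  have hb : ModelFrobenioid.baseMap φP.1 = b := (P.toBase tf.toElem).map_preimage b'
  exact ⟨φP.1, φP.2, hb⟩

include hΦd in
/-- **GAP row G-L2t4-1 (`hcomp`) at the canonical model — [EtTh] Prop. 5.2 (i), first alternative from the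
second; Rmk. 4.3.2.**  For `Φ` divisorial, an `l`-th root datum `Rl` of a right fraction-pair `Pl` of
`θ = Θ̈ ∈ O^×(A_⊙^birat)` and an `N`-th root datum `R` of the root's pair, the pair `(s^⊓_N, s^⊔_N) :=
(R.pair.num, R.pair.den)` constitutes an `l·N`-th root of `Pl`, PROVIDED the `N`-domain `A_N` lies in a
skeleton through `A_⊙` (`hsk`), is `μ_{l·N}`-saturated (`hμ`) and satisfies condition (a) of Def. 4.1 (iii)
at level `l·N` (`hcondA`) — print: «the "(l·N, H_⊙, f|_{A_{l·N}})-saturated-ness" condition … follows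
immediately from the definition of the field `J̈_{l·N}`».  The `l·N`-th root is `(A_N, B_N, α, β, f_N,
(s^⊓_N, s^⊔_N))` with `α := F(l·N)_{A_N} ≫ φ` through the model's base-Frobenius pair containing `A_N, A_⊙`
(Def. 4.1 (iv)(a)–(e) by construction) and `β` from the root squares (L04).
[cite: MochizukiEtTh2009, Prop 5.2 (i) p.324 (PDF p.98)] -/
theorem pairIsNthRootOf_comp_mkOfModelCanonical
    {Bl : tf.category} {θ : tf.biratUnitsModel A₀}
    {Pl : (mkOfModelCanonical X tf hZ hP IG gS gSs NH A₀ hA₀ hA₀').FractionPair θ Bl} {lv N : ℕ+}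
    (Rl : (mkOfModelCanonical X tf hZ hP IG gS gSs NH A₀ hA₀ hA₀').NthRoot θ Pl lv
      (fun {_} φ x => tf.pullFracModel φ x))
    (R : (mkOfModelCanonical X tf hZ hP IG gS gSs NH A₀ hA₀ hA₀').NthRoot Rl.root Rl.pair N
      (fun {_} φ x => tf.pullFracModel φ x))
    (hsk : Nonempty (R.AN.base ≅ A₀.base) → R.AN = A₀)
    (hμ : tf.IsMuSaturated R.AN (lv * N))
    (hcondA : ∃ (A' A'' : tf.category) (s₁ : A' ⟶ R.AN) (s₂ : A' ⟶ A''),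
      (mkOfModelCanonical X tf hZ hP IG gS gSs NH A₀ hA₀ hA₀').IsPreStep s₁ ∧
        (mkOfModelCanonical X tf hZ hP IG gS gSs NH A₀ hA₀ hA₀').IsPreStep s₂ ∧
          (mkOfModelCanonical X tf hZ hP IG gS gSs NH A₀ hA₀ hA₀').IsFrobeniusTrivial A'' ∧
            (mkOfModelCanonical X tf hZ hP IG gS gSs NH A₀ hA₀ hA₀').IsNHSaturatedBsFld
              (mkOfModelCanonical X tf hZ hP IG gS gSs NH A₀ hA₀ hA₀').HodotBsFld A'' (lv * N)) :
    (mkOfModelCanonical X tf hZ hP IG gS gSs NH A₀ hA₀ hA₀').PairIsNthRootOf (fun {_ _} φ x => tf.pullFracModel φ x)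
      ((lv : ℕ) * N) θ R.pair.num R.pair.den := by
  -- the natural pull-back morphism `A_N → A_⊙` over the composite base, `α'_N ≫ α'_l`
  have hφ₀ : (mkOfModelCanonical X tf hZ hP IG gS gSs NH A₀ hA₀ hA₀').IsPullback (R.αData.α₁ ≫ Rl.αData.α₁) :=
    PreFrobenioid.IsPullbackMorphism.comp _ R.αData.cond_d Rl.αData.cond_d
  -- a base-Frobenius pair through `A_N`, `A_⊙` and its arrow `φ` over `Base(α'_N ≫ α'_l)`
  obtain ⟨P, Fr, hPF, hAN, hA0⟩ := exists_isBaseFrobeniusPair_obj_obj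
    (mkOfModelCanonical X tf hZ hP IG gS gSs NH A₀ hA₀ hA₀').tf A₀ hA₀ hΦd R.AN (R.αData.α₁ ≫ Rl.αData.α₁) hφ₀ hsk
  obtain ⟨φ, hφP, hb⟩ := exists_hom_over_of_isBaseSection (mkOfModelCanonical X tf hZ hP IG gS gSs NH A₀ hA₀ hA₀').tf
    hPF.isBaseSection hAN hA0 (ModelFrobenioid.baseMap (R.αData.α₁ ≫ Rl.αData.α₁))
  -- data of base-Frobenius type for `α := F(l·N)_{A_N} ≫ φ` (Def. 4.1 (iv)(a)–(e) by construction)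
  obtain ⟨α, d, hd, hiso, hdeg⟩ := Prop42Sub.exists_baseFrobeniusTypeData_of_isDistinguished
    (mkOfModelCanonical X tf hZ hP IG gS gSs NH A₀ hA₀ hA₀') hΦd (fun _ _ _ h => h) hPF φ hφP
    R.αData.isGalois (lv * N) hμ
  have hbd : ModelFrobenioid.baseMap d.α₁ =
      ModelFrobenioid.baseMap R.αData.α₁ ≫ ModelFrobenioid.baseMap Rl.αData.α₁ := by
    rw [hd, hb, ModelFrobenioid.baseMap_comp]
  -- the laws of the pull-back of birational units at the model: multiplicativity and functoriality
  have hmul : ∀ (x : (mkOfModelCanonical X tf hZ hP IG gS gSs NH A₀ hA₀ hA₀').biratUnits Rl.AN) (n : ℕ),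
      tf.pullFracModel R.αData.α₁ (x ^ n) = tf.pullFracModel R.αData.α₁ x ^ n :=
    fun x n => map_pow (tf.pullFracModel R.αData.α₁) x n
  have hφ : tf.pullFracModel d.α₁ θ = tf.pullFracModel R.αData.α₁ (tf.pullFracModel Rl.αData.α₁ θ) := by
    rw [tf.pullFracModel_eq_of_baseMap_eq (hbd.trans (ModelFrobenioid.baseMap_comp _ _).symm)]
    exact tf.pullFracModel_comp_apply _ _ _
  -- `f_N^{l·N} = (α')^* Θ̈`, the level-`l·N` saturation of `A_N`, the divisor bookkeeping
  have hroot := NthRoot.pow_root_mul_of_laws (S := mkOfModelCanonical X tf hZ hP IG gS gSs NH A₀ hA₀ hA₀')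
    (pullFrac := fun {_ _} φ x => tf.pullFracModel φ x) Rl R d.α₁ hmul hφ
  have hsat := NthRoot.isSaturated_mul_of_laws (S := mkOfModelCanonical X tf hZ hP IG gS gSs NH A₀ hA₀ hA₀')
    (pullFrac := fun {_ _} φ x => tf.pullFracModel φ x) Rl R d.α₁ hmul hφ hcondA
  have hQn := NthRoot.div_num_pow_mul (S := mkOfModelCanonical X tf hZ hP IG gS gSs NH A₀ hA₀ hA₀')
    (pullFrac := fun {_ _} φ x => tf.pullFracModel φ x) Rl R d.α₁ hbd
  have hQd := NthRoot.div_den_pow_mul (S := mkOfModelCanonical X tf hZ hP IG gS gSs NH A₀ hA₀ hA₀')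
    (pullFrac := fun {_ _} φ x => tf.pullFracModel φ x) Rl R d.α₁ hbd
  -- `β` from the root squares (L04 at the model, unconditional)
  have h₄ : Prop42Sub.RootSquares (mkOfModelCanonical X tf hZ hP IG gS gSs NH A₀ hA₀ hA₀')
      (fun {_ _} φ x => tf.pullFracModel φ x) :=
    rootSquares_mkOfModel tf hZ hP T.isUnit_BΛ _ IG gS gSs NH _ A₀ hA₀ hA₀'
  obtain ⟨β, hβiso, hβdeg, hcn, hcd⟩ := h₄ θ Pl (lv * N) R.AN α d R.root R.BN R.pair hiso hdeg hroot hQn hQd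
  exact NthRoot.pairIsNthRootOf_mul_of_data (S := mkOfModelCanonical X tf hZ hP IG gS gSs NH A₀ hA₀ hA₀')
    (pullFrac := fun {_ _} φ x => tf.pullFracModel φ x) Rl R α d hiso hdeg hroot hsat β hβiso hβdeg hcn hcd

include hΦd in
/-- **The same discharge, stated for a GENERIC pull-back parameter `pullFrac` that EQUALS `pullFracModel`**
(the shape in which abc-iut-L2-t4's §5 constructors `ofBiKummerData` / `ofTemperoidData` /
`thetaPairIsRoot_ofModelData` carry `pullFrac`: a free parameter plus laws) — so that the `hcomp` binder is
discharged inside such a generic context by this theorem plus the one-line law `hpf` (proved by `rfl` /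
`funext` at the specialisation `pullFrac := pullFracModel`), without re-typing the root data `Rl`, `R`.
[cite: MochizukiEtTh2009, Prop 5.2 (i) p.324 (PDF p.98)] -/
theorem pairIsNthRootOf_comp_mkOfModelCanonical_of_pullFrac_eq
    (pullFrac : ∀ {A A' : (mkOfModelCanonical X tf hZ hP IG gS gSs NH A₀ hA₀ hA₀').C} (_ : A' ⟶ A),
      (mkOfModelCanonical X tf hZ hP IG gS gSs NH A₀ hA₀ hA₀').biratUnits A →
        (mkOfModelCanonical X tf hZ hP IG gS gSs NH A₀ hA₀ hA₀').biratUnits A')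
    (hpf : @pullFrac = fun {A A' : (mkOfModelCanonical X tf hZ hP IG gS gSs NH A₀ hA₀ hA₀').C} (φ : A' ⟶ A)
      (x : (mkOfModelCanonical X tf hZ hP IG gS gSs NH A₀ hA₀ hA₀').biratUnits A) => tf.pullFracModel φ x)
    {Bl : tf.category} {θ : tf.biratUnitsModel A₀}
    {Pl : (mkOfModelCanonical X tf hZ hP IG gS gSs NH A₀ hA₀ hA₀').FractionPair θ Bl} {lv N : ℕ+}
    (Rl : (mkOfModelCanonical X tf hZ hP IG gS gSs NH A₀ hA₀ hA₀').NthRoot θ Pl lv pullFrac)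
    (R : (mkOfModelCanonical X tf hZ hP IG gS gSs NH A₀ hA₀ hA₀').NthRoot Rl.root Rl.pair N pullFrac)
    (hsk : Nonempty (R.AN.base ≅ A₀.base) → R.AN = A₀)
    (hμ : tf.IsMuSaturated R.AN (lv * N))
    (hcondA : ∃ (A' A'' : tf.category) (s₁ : A' ⟶ R.AN) (s₂ : A' ⟶ A''),
      (mkOfModelCanonical X tf hZ hP IG gS gSs NH A₀ hA₀ hA₀').IsPreStep s₁ ∧
        (mkOfModelCanonical X tf hZ hP IG gS gSs NH A₀ hA₀ hA₀').IsPreStep s₂ ∧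
          (mkOfModelCanonical X tf hZ hP IG gS gSs NH A₀ hA₀ hA₀').IsFrobeniusTrivial A'' ∧
            (mkOfModelCanonical X tf hZ hP IG gS gSs NH A₀ hA₀ hA₀').IsNHSaturatedBsFld
              (mkOfModelCanonical X tf hZ hP IG gS gSs NH A₀ hA₀ hA₀').HodotBsFld A'' (lv * N)) :
    (mkOfModelCanonical X tf hZ hP IG gS gSs NH A₀ hA₀ hA₀').PairIsNthRootOf pullFrac
      ((lv : ℕ) * N) θ R.pair.num R.pair.den := by
  subst hpf
  exact pairIsNthRootOf_comp_mkOfModelCanonical X tf hZ hP IG gS gSs NH A₀ hA₀ hA₀' hΦd Rl R hsk hμ hcondA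

end Canonical

end BiKummerSetting

end Literature.AnabelianGeometry.EtaleTheta

end
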